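import Literature.NumberTheory.DiophantineGeometry.AbelianSchemeModelOfSmoothProperModel
import Literature.NumberTheory.EllipticCurves.NeronModelProperOfGoodReduction
import Literature.NumberTheory.EllipticCurves.NeronModelExistenceLocalSplit
import HarnessLib

/-!
# The bridge `r₀` from the existence of Néron models

Topic `Literature/NumberTheory/DiophantineGeometry`; namespace
`Literature.NumberTheory.DiophantineGeometry`.  KERNEL ONLY: theorems; no definition, no named
fact, no `sorry`.

The named fact `exists_isAbelianSchemeModel_of_hasGoodReductionAt` (Bombieri–Gubler 10.3.9: an
abelian variety over a number field whose underlying variety has a smooth proper model over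
`𝓞_{K,v}` has an abelian-scheme model at `v`) follows from the existence of Néron models over the
discrete valuation rings `𝓞_{K,v}` (the tree's named fact
`Literature.NumberTheory.EllipticCurves.exists_isNeronModel 𝓞_{K,v} K`, Néron 1964 /
Bosch–Lütkebohmert–Raynaud Cor. 1.3/2, local case): the Néron model of `A` at a place of good
reduction is proper (BLR Prop. 1.2/8,
`Literature.NumberTheory.EllipticCurves.IsSchematicNeronModel.isProper_of_isProper_of_smooth`),
hence an abelian-scheme model
(`Literature.NumberTheory.EllipticCurves.exists_isAbelianSchemeModel_of_hasGoodReductionAt_of_exists_isNeronModel`).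

* `exists_isAbelianSchemeModel_of_hasGoodReductionAt_of_forall_exists_isNeronModel` — the
  implication between the two named facts (Néron existence at every finite place of every number
  field ⇒ `r₀`).
  (The pointwise form at one place `v`, from `exists_isNeronModel 𝓞_{K,v} K` alone, is
  `Literature.NumberTheory.EllipticCurves.exists_isAbelianSchemeModel_of_hasGoodReductionAt_of_exists_isNeronModel`.)
* `exists_isAbelianSchemeModel_of_hasGoodReductionAt_of_strictlyLocal` — `r₀` from Artin's two
  printed layers of the local existence theorem (the tree's named facts
  `exists_isNeronModel_strictlyLocal`, `neronModel_descent_strictlyLocal`, assembled by the PROVED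
  `exists_isNeronModel_holds_of`).

## References
* [BLRNeronModels1990] S. Bosch, W. Lütkebohmert, M. Raynaud, *Néron Models*, Springer 1990,
  §1.2 Prop. 8, §1.3 Cor. 2.
* [BombieriGubler2006] E. Bombieri, W. Gubler, *Heights in Diophantine Geometry*, CUP 2006, 10.3.9.
-/

set_option autoImplicit false

noncomputable section

open CategoryTheory AlgebraicGeometry IsDedekindDomain IsDedekindDomain.HeightOneSpectrum
open scoped NumberField

namespace Literature.NumberTheory.DiophantineGeometry

open Literature.AlgebraicGeometry.Motives Literature.NumberTheory.EllipticCurves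

/-- **Néron existence ⇒ `r₀`.** If Néron models exist over `𝓞_{K,v}` for every number field `K`
and every finite place `v` (the tree's named fact `exists_isNeronModel`, Néron 1964 / BLR
Cor. 1.3/2 in the local case), then the named fact
`exists_isAbelianSchemeModel_of_hasGoodReductionAt` (Bombieri–Gubler 10.3.9) holds: a smooth
proper model at `v` upgrades to an abelian-scheme model at `v`, namely the Néron model, which is
proper by BLR Prop. 1.2/8. [cite: BLRNeronModels1990, §1.2 Prop. 8 and §1.3 Cor. 2]
[cite: BombieriGubler2006, 10.3.9] -/
theorem exists_isAbelianSchemeModel_of_hasGoodReductionAt_of_forall_exists_isNeronModel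
    (h : ∀ (K : Type) [Field K] [NumberField K] (v : HeightOneSpectrum (𝓞 K)),
      exists_isNeronModel (valuationSubringAtPrime K v) K) :
    exists_isAbelianSchemeModel_of_hasGoodReductionAt := by
  intro K _ _ A v hA
  exact exists_isAbelianSchemeModel_of_hasGoodReductionAt_of_exists_isNeronModel A v (h K v) hA

/-- **`r₀` from Artin's two local layers of Néron's existence theorem.** Existence of Néron
models over strictly local discrete valuation rings (`exists_isNeronModel_strictlyLocal`, Artin
§3 / BLR Chs. 3–5) and the descent to all discrete valuation rings
(`neronModel_descent_strictlyLocal`, Artin §4 / BLR §6.5) give Néron models over every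
`𝓞_{K,v}` (`exists_isNeronModel_holds_of`, proved), hence `r₀`.
[cite: BLRNeronModels1990, §1.2 Prop. 8 and §1.3 Cor. 2]
[cite: Artin1986NeronModels, Thm. (1.2) (proof, p. 228)] -/
theorem exists_isAbelianSchemeModel_of_hasGoodReductionAt_of_strictlyLocal
    (h₁ : exists_isNeronModel_strictlyLocal.{0}) (h₂ : neronModel_descent_strictlyLocal.{0}) :
    exists_isAbelianSchemeModel_of_hasGoodReductionAt :=
  exists_isAbelianSchemeModel_of_hasGoodReductionAt_of_forall_exists_isNeronModel
    fun K _ _ v => exists_isNeronModel_holds_of h₁ h₂ (valuationSubringAtPrime K v) K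

end Literature.NumberTheory.DiophantineGeometry

end
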